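import Literature.AnabelianGeometry.EtaleTheta.TemperedFilterClosureNormal
import Literature.AlgebraicGeometry.Frobenioids.QuasiTemperoidConnected

/-!
# [EtTh] Def. 3.3 (i)(c)/(ii): the LEVEL of a connected tempered covering — the index of its `Δ^fil`-closure

S. Mochizuki, *The étale theta function …*, Publ. RIMS **45** (2009) [MochizukiEtTh2009], §3 Def. 3.3 (i)(c) PDF p.72
(«for each open subgroup `H ⊆ Δ`, there exists a [necessarily unique] `i_H ∈ I` such that `Δ^{fil,∞}_{i_H} ⊆ H`, and,
moreover, for every `i ∈ I`, `Δ^{fil,∞}_i ⊆ H` implies `Δ^{fil,∞}_i ⊆ Δ^{fil,∞}_{i_H}`»), (ii) p.73 («if, moreover,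
`Y^log → X^log` is a connected tempered covering, which determines an open subgroup `H ⊆ Δ^tp_X`, and `Δ^{fil,∞}_i ⊆ H`
is the `Δ^fil`-closure of `H`, then we shall refer to any covering `Z^log_∞ → Y^log` whose composite with
`Y^log → X^log` is the covering `Z^log_∞ → X^log` as a `Δ^fil`-closure of `Y^log → X^log`»), (iii) p.74 («by (i), (c),
the assignments … determine functors») [cite: MochizukiEtTh2009, Def 3.3 (ii) p.73].

abc-iut cell, layer L2; FOUNDATIONS / v-next row «LogDivisorModel v2 (covering-indexed Mero)» (abc-iut-L2-lead R342/R387;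
design memo `HOME/staging/L2/L2-t3/VNEXT-LogDivisorModelV2-DESIGN.md`); seat abc-iut-L2-t3 (gen 5), owner of Def. 3.3
(i)–(ii).  CLASS (b): ONE structure-with-data `LevelSystem` + constructors; inputs BY NAME (`TemperedFilter`,
`TemperedFilterOn`, `geometricPart` — this seat's Def. 3.3 (i)/(ii) typing; `TemperedFilterOn.closure_normal` —
p448677; `ConnectedPart (BTemp Π)` and abc-iut-L1's `BTempConnected` API — [FrdII] Ex. 1.3); no instance / notation /
Prop-fact; nothing landed is edited.
* §1 `LevelSystem Π` — what Def. 3.3 (iii) USES of (i)(c)/(ii): levels `i`, the subgroups `Δ^{fil,∞}_i ⊴ Π`, the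
  level `lvl Y` of a connected tempered covering `Y` (its `Δ^fil`-closure), with «`Δ^{fil,∞}_{lvl Y}` acts trivially on
  `Y`» and MONOTONICITY `Y' → Y ⇒ Δ^{fil,∞}_{lvl Y'} ⊆ Δ^{fil,∞}_{lvl Y}`; `LevelSystem.single` (one level, `Δ^{fil,∞} = 1`:
  the v1 situation).
* §2 **`LevelSystem.ofTemperedFilter X F`** — CONSTRUCTED from a tempered filter on `X^log`: `lvl Y := i_H` for `H` = the
  geometric part of the stabiliser of a point of `Y`; both laws PROVED (trivial action: `Δ^{fil,∞}_{i_H} ⊆ H` +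
  normality + transitivity; monotonicity: Def. 3.3 (i)(c) + surjectivity of covering maps of connected coverings).
HONEST FRAMING: interface + constructor over the typed tempered-filter data (no tempered filter of an actual curve is
constructed in the tree); nothing here bears on [IUTchIII] Cor. 3.12; typed ≠ proved — §2's laws are proved.
-/

noncomputable section

namespace Literature.AnabelianGeometry.EtaleTheta

open CategoryTheory Literature.AlgebraicGeometry.Frobenioids Literature.AlgebraicGeometry.Frobenioids.QuasiTemperoid
  Literature.AnabelianGeometry.SemiGraphs

universe u

/-! ### §1 The level structure -/

/-- **The level structure of Def. 3.3 (i)(c), (ii)** as used by (iii): an index set of levels `i`, the subgroups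
`Δ^{fil,∞}_i` (normal in `Π^tp_X`: characteristic in `Δ^tp_X`, `TemperedFilterOn.closure_normal`), and for every
connected tempered covering `Y` (object of `B^temp(Π)⁰`) its level `lvl Y` = the index of its `Δ^fil`-closure, such
that `Δ^{fil,∞}_{lvl Y}` acts trivially on `Y` («`Δ^{fil,∞}_{i_H} ⊆ H`») and levels are MONOTONE along covering maps
(«`Δ^{fil,∞}_i ⊆ H` implies `Δ^{fil,∞}_i ⊆ Δ^{fil,∞}_{i_H}`»). [cite: MochizukiEtTh2009, Def 3.3 (i) p.72] -/
structure LevelSystem (P : Type u) [Group P] [TopologicalSpace P] : Type (u + 1) where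
  /-- the index set `I` of the tempered filter -/
  I : Type u
  /-- `Δ^{fil,∞}_i ⊆ Π` -/
  closure : I → Subgroup P
  /-- `Δ^{fil,∞}_i` is normal in `Π` -/
  closure_normal : ∀ i, (closure i).Normal
  /-- the level (index of the `Δ^fil`-closure) of a connected tempered covering -/
  lvl : ConnectedPart (BTemp P) → I
  /-- `Δ^{fil,∞}_{lvl Y}` acts trivially on `Y` -/
  closure_lvl_act : ∀ (Y : ConnectedPart (BTemp P)) (g : P), g ∈ closure (lvl Y) → ∀ y : Y.obj.obj.V, Y.obj.obj.ρ g y = y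
  /-- monotonicity along covering maps `Y' → Y` -/
  closure_lvl_mono : ∀ {Y Y' : ConnectedPart (BTemp P)} (_ : Y' ⟶ Y), closure (lvl Y') ≤ closure (lvl Y)

namespace LevelSystem

section Single

variable (P : Type u) [Group P] [TopologicalSpace P]

/-- The one-level system: a single index, `Δ^{fil,∞} = 1` (every covering read at the same `Z^log_∞`) — the v1
situation «coverings dominated by one universal combinatorial covering». [cite: MochizukiEtTh2009, Def 3.3 (iii) p.73] -/
def single : LevelSystem P where
  I := PUnit
  closure _ := ⊥
  closure_normal _ := inferInstance
  lvl _ := PUnit.unit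
  closure_lvl_act Y g hg y := by
    rw [Subgroup.mem_bot] at hg
    subst hg
    exact BTempConnected.ρ_one_apply Y.obj y
  closure_lvl_mono _ := le_rfl

end Single

/-! ### §2 The level structure OF A TEMPERED FILTER on `X^log` -/

section OfTemperedFilter

variable {K : Type u} [Field K] (X : TemperedArithmeticGroup.{u} K) (F : TemperedFilterOn X)

/-- The stabiliser of a point of a tempered `Π`-set, an OPEN subgroup of `Π` ([SemiAnbd] §3: objects of `B^temp(Π)` have
open stabilisers) — the open subgroup «determined by» the connected tempered covering, Def. 3.3 (ii).
[cite: MochizukiEtTh2009, Def 3.3 (ii) p.73] -/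
def stabOpen (T : BTemp X.Pi) (y : T.obj.V) : OpenSubgroup X.Pi where
  carrier := {g | T.obj.ρ g y = y}
  mul_mem' {a b} ha hb := by
    show T.obj.ρ (a * b) y = y
    rw [BTempConnected.ρ_mul_apply, hb, ha]
  one_mem' := BTempConnected.ρ_one_apply T y
  inv_mem' {a} ha := by
    show T.obj.ρ a⁻¹ y = y
    conv_lhs => rw [← ha]
    exact BTempConnected.ρ_inv_apply T a y
  isOpen' := T.property.2 y

/-- Membership in the stabiliser. [cite: MochizukiEtTh2009, Def 3.3 (ii) p.73] -/
@[simp] theorem mem_stabOpen (T : BTemp X.Pi) (y : T.obj.V) (g : X.Pi) : g ∈ stabOpen X T y ↔ T.obj.ρ g y = y := Iff.rfl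

/-- A chosen point of a connected tempered covering (connected objects of `B^temp(Π)` are nonempty,
`BTempConnected.nonempty_of_isConnectedObj`). [cite: MochizukiFrdII2008, Ex 1.3 (ii) p.11] -/
def pt (Y : ConnectedPart (BTemp X.Pi)) : Y.obj.obj.V :=
  (BTempConnected.nonempty_of_isConnectedObj Y.obj Y.property).some

/-- **The level `i_H` of a connected tempered covering `Y`** (Def. 3.3 (ii)): the index of the `Δ^fil`-closure of the
geometric part `H ∩ Δ^tp_X` of the stabiliser `H` of (a point of) `Y`. [cite: MochizukiEtTh2009, Def 3.3 (ii) p.73] -/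
def lvlOf (Y : ConnectedPart (BTemp X.Pi)) : F.I := F.indexOf (geometricPart (stabOpen X Y.obj (pt X Y)))

/-- `Δ^{fil,∞}_{i_H}` (in `Π`) fixes the chosen point: «`Δ^{fil,∞}_{i_H} ⊆ H`». [cite: MochizukiEtTh2009, Def 3.3 (i) p.72] -/
theorem closure_lvlOf_fix_pt (Y : ConnectedPart (BTemp X.Pi)) {g : X.Pi}
    (hg : g ∈ (F.closure (lvlOf X F Y)).map X.delta.subtype) : Y.obj.obj.ρ g (pt X Y) = pt X Y := by
  obtain ⟨d, hd, rfl⟩ := hg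
  have h := F.closure_indexOf_le (geometricPart (stabOpen X Y.obj (pt X Y))) hd
  exact h

/-- `Δ^{fil,∞}_{i_H}` fixes EVERY point of the connected covering `Y` (it is normal in `Π` and `Y` is one orbit).
[cite: MochizukiEtTh2009, Def 3.3 (ii) p.73] -/
theorem closure_lvlOf_fix (Y : ConnectedPart (BTemp X.Pi)) {g : X.Pi}
    (hg : g ∈ (F.closure (lvlOf X F Y)).map X.delta.subtype) (y : Y.obj.obj.V) : Y.obj.obj.ρ g y = y := by
  haveI := TemperedFilterOn.closure_normal X F (lvlOf X F Y)
  obtain ⟨h, rfl⟩ := BTempConnected.exists_ρ_eq_of_isConnectedObj Y.obj Y.property (pt X Y) y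
  have hconj : h⁻¹ * g * h ∈ (F.closure (lvlOf X F Y)).map X.delta.subtype := by
    have := Subgroup.Normal.conj_mem inferInstance g hg h⁻¹
    rwa [inv_inv] at this
  calc Y.obj.obj.ρ g (Y.obj.obj.ρ h (pt X Y))
      = Y.obj.obj.ρ h (Y.obj.obj.ρ (h⁻¹ * g * h) (pt X Y)) := by
          rw [← BTempConnected.ρ_mul_apply, ← BTempConnected.ρ_mul_apply]
          congr 1; group
    _ = Y.obj.obj.ρ h (pt X Y) := by rw [closure_lvlOf_fix_pt X F Y hconj]

/-- **Monotonicity of levels** (Def. 3.3 (i)(c) + surjectivity of covering maps between connected coverings): for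
`f : Y' → Y`, `Δ^{fil,∞}_{i_{H'}} ⊆ Δ^{fil,∞}_{i_H}`. [cite: MochizukiEtTh2009, Def 3.3 (i) p.72] -/
theorem closure_lvlOf_mono {Y Y' : ConnectedPart (BTemp X.Pi)} (f : Y' ⟶ Y) :
    (F.closure (lvlOf X F Y')).map X.delta.subtype ≤ (F.closure (lvlOf X F Y)).map X.delta.subtype := by
  apply Subgroup.map_mono
  apply F.closure_le_closure_indexOf
  intro d hd
  -- `d` fixes every point of `Y'`, hence `f(y') = pt Y` for a preimage `y'` of the base point
  obtain ⟨y', hy'⟩ := BTempConnected.surjective_of_isConnectedObj (pt X Y') Y.property f.hom (pt X Y)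
  have hfix : Y'.obj.obj.ρ (d : X.Pi) y' = y' := closure_lvlOf_fix X F Y' ⟨d, hd, rfl⟩ y'
  show Y.obj.obj.ρ (d : X.Pi) (pt X Y) = pt X Y
  rw [← hy', ← BTempConnected.hom_ρ, hfix]

/-- **The level structure of a tempered filter on `X^log`** (Def. 3.3 (i)(c)/(ii) CONSTRUCTED): `Δ^{fil,∞}_i ⊴ Π^tp_X`
(p448677), `lvl Y := i_H` for the geometric part `H` of a point stabiliser, both laws proved.
[cite: MochizukiEtTh2009, Def 3.3 (ii) p.73] -/
def ofTemperedFilter : LevelSystem X.Pi where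
  I := F.I
  closure i := (F.closure i).map X.delta.subtype
  closure_normal i := TemperedFilterOn.closure_normal X F i
  lvl := lvlOf X F
  closure_lvl_act Y _ hg y := closure_lvlOf_fix X F Y hg y
  closure_lvl_mono f := closure_lvlOf_mono X F f

/-- The levels of `ofTemperedFilter` are the filter's indices. [cite: MochizukiEtTh2009, Def 3.3 (ii) p.73] -/
theorem ofTemperedFilter_I : (ofTemperedFilter X F).I = F.I := rfl

/-- `Δ^{fil,∞}_i` of `ofTemperedFilter` is the filter's closure viewed in `Π`. [cite: MochizukiEtTh2009, Def 3.3 (ii) p.73] -/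
theorem ofTemperedFilter_closure (i : F.I) :
    (ofTemperedFilter X F).closure i = (F.closure i).map X.delta.subtype := rfl

/-- The level of `Y` is the index of the `Δ^fil`-closure of the geometric part of a point stabiliser.
[cite: MochizukiEtTh2009, Def 3.3 (ii) p.73] -/
theorem ofTemperedFilter_lvl (Y : ConnectedPart (BTemp X.Pi)) :
    (ofTemperedFilter X F).lvl Y = F.indexOf (geometricPart (stabOpen X Y.obj (pt X Y))) := rfl

end OfTemperedFilter

end LevelSystem

end Literature.AnabelianGeometry.EtaleTheta

end
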